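import Summits.QuantumFields.YangMills.Theorems.SwapVirialDeficitBlowUpPeriodicTwoScalePointwise
import Summits.QuantumFields.YangMills.Theorems.SwapVirialDeficitPeriodicPrincipalLogLimitAE
import HarnessLib

/-!
# The PERIODIC massive-mode rung AT FIXED `L`, UNCONDITIONALLY: brick (B2) = product-good level + positivity of the limit + assembly
# (free-hands support of ⟨stmt-QuantumFields-24196⟩ `SwapVirialDeficit.ToronSoftnessSharp`; LEAD memo `sfw-p2-g96-memo-24196-PM-design.md` §2
# «good-threshold route» + ARCHITECTURE NOTE 14:32Z; consumes ✓(B1) `…BlowUpPeriodicTwoScalePointwise` and ✓(A) `…PeriodicPrincipalLogLimitAE`)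

* ★ `exists_good_level` — some `r ∈ (1/2, 1)` whose limit level set `{Φ(0,0;a₀,·) = r}` is null for a.e. hub value `a₀` (✓`exists_good_level_Ioo` for the
  σ-finite product `vol_{a₀} ⊗ vol³ ⊗ vol^{Fol}`, then Fubini `Measure.ae_ae_of_ae_prod`);
* ★★ `measure_twoScaleLimitSet_pos` — `μ(twoScaleLimitSet L r a₀) > 0` (`r > 0`, `a₀ ≠ 0`): the totally-real test configuration `x = y′ = z = y_f = 1/2` has
  `G ≡ 0` (★ `twoScaleDeficit_half_eq_zero`: its raw letters move inside the abelian direction `span{1,i}` of `Â`, ✓`hatA_abelDir_eq_zero`), hence `Φ(0,0) = 0 < r`,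
  and the limit set contains an open neighbourhood of it (open cores of K4's ✓`domSet4` and of the follower box);
* ★★★★ `relativeGap_fixedL_periodic (hε) : ∃ L₀, ∀ L ≥ L₀, ∃ β₀, ∀ β ≥ β₀, β(log twistTrace_L)′(β) − β(log physTrace_L)′(β) ≤ −(1/2 − 2ε)`;
* ★★★★ `periodicMeanAction_fixedL (L) : b·(log sectorWeight_L(b))′ − 12 b L⁴ → −(9L⁴ − 3/2)` (`b → ∞`)
  — ✓`relativeGap_fixedL_of_twoScaleLimit_ae` / ✓`periodicMeanAction_fixedL_of_twoScale_ae` fed with `M_r(a₀) = μ(twoScaleLimitSet L r a₀)`,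
  ✓`tendsto_twoScaleVolumeR_of_null`, ✓`measurable_twoScaleVolumeR_hub`, w3 g64's ✓`volume_twoScaleDominator_lt_top`.
HONEST LABEL: these are the FIXED-`L`, `β → ∞` statements (the periodic massive-mode rung of a DRAFT line, now a theorem at each fixed `L`); the
window-uniform / uniform-in-`L` statements ⟨24196⟩ ⟨24194⟩ ⟨24197⟩ ⟨24497⟩ remain OPEN; own crux ⟨22884⟩ OPEN (blocked-on ⟨19935⟩); the Yang–Mills mass gap
is NOT proved; no summit is proved by a line.
LEAD seat ym-line-sfw-p2 g96 (cell ym-idea-1, free hands), `--supports stmt-QuantumFields-24196`.  THEOREMS ONLY, standard axioms, 0 `sorry`.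
References: [cite: Luscher1983, §2]; [cite: GonzalezarroyoAltes1988]; [cite: tHooft1979]; [cite: Griffiths1964]; [folklore].
-/

set_option autoImplicit false
set_option synthInstance.maxSize 1024

noncomputable section

open MeasureTheory Quaternion Set Filter Topology
open scoped Quaternion ENNReal BigOperators
open Literature.MathematicalPhysics.QuantumLattice
open Literature.MathematicalPhysics.QuantumFieldTheory hiding SU2
open Summit.QuantumFields.YangMills.Theorems.SwapTwistDeficit.ToronLog

attribute [local instance] Literature.Analysis.FluidPDE.Tao2016.quatMeasurableSpace
  Literature.Analysis.FluidPDE.Tao2016.quatBorelSpace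
  Literature.MathematicalPhysics.QuantumLattice.secondCountableTopology_su2

namespace Summit.QuantumFields.YangMills.Theorems.SwapVirialDeficit.BlowUpRing

open Summit.QuantumFields.YangMills.Theorems.FemtoTransferGap
open Summit.QuantumFields.YangMills.Theorems.FemtoTransferGap.TT
open Summit.QuantumFields.YangMills.Theorems.SwapVirialDeficit.ZeroModeSigma (ball3 mem_ball3_iff dilateIm dilateIm_apply)
open Summit.QuantumFields.YangMills.Theorems.SwapVirialDeficit.ZeroModeGroup
open Summit.QuantumFields.YangMills.Theorems.SwapVirialDeficit.BlowUp (axialLetters dil3P dil3P_apply frobNorm_quatToSU2_sub_one_sq)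
open Summit.QuantumFields.YangMills.Theorems.SwapVirialDeficit.TwoScaleCalculus

variable {L : ℕ} [NeZero L]


/-! ## §3 Good levels, positivity of the limit, and the UNCONDITIONAL fixed-`L` periodic rung -/

/-- ★ **A PRODUCT-good level**: some `r ∈ (1/2, 1)` whose limit level set is null for a.e. hub value `a₀`
(✓`exists_good_level_Ioo` for `vol_{a₀} ⊗ μ`, then Fubini). [folklore] -/
theorem exists_good_level :
    ∃ r ∈ Set.Ioo (1 / 2 : ℝ) 1, ∀ᵐ a₀ : ℝ ∂(volume : Measure ℝ), ∀ᵐ ξ : Xi L ∂(muXi L),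
      ((a₀, ξ) : ℝ × Xi L) ∈ sliceGood L → twoScalePhi L 0 0 a₀ ξ.1 ξ.2 ≠ r := by
  classical
  set Φt : ℝ × Xi L → ℝ := (sliceGood L).piecewise (fun z => twoScalePhi L 0 0 z.1 z.2.1 z.2.2) (fun _ => 0) with hΦt
  have hΦm : Measurable Φt :=
    ContinuousOn.measurable_piecewise continuousOn_twoScalePhi_zero continuousOn_const isOpen_sliceGood.measurableSet
  obtain ⟨r, hr, hnull⟩ := exists_good_level_Ioo ((volume : Measure ℝ).prod (muXi L)) hΦm (show (1 / 2 : ℝ) < 1 by norm_num)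
  refine ⟨r, hr, ?_⟩
  have hae : ∀ᵐ z : ℝ × Xi L ∂((volume : Measure ℝ).prod (muXi L)), Φt z ≠ r := by
    rw [ae_iff]; simpa only [ne_eq, not_not] using hnull
  filter_upwards [Measure.ae_ae_of_ae_prod hae] with a₀ ha
  filter_upwards [ha] with ξ hξ hsl
  rwa [hΦt, Set.piecewise_eq_of_mem _ _ _ hsl] at hξ

/-- `∂_vᵏ` of the zero function is zero. [folklore] -/
theorem dirDerivIter_const_zero {E : Type*} [NormedAddCommGroup E] [NormedSpace ℝ E] (v : E) (k : ℕ) :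
    dirDerivIter v k (fun _ : E => (0 : ℝ)) = fun _ => 0 := by
  induction k with
  | zero => rfl
  | succ k ih =>
    show (dirDeriv v)^[k + 1] (fun _ : E => (0 : ℝ)) = fun _ => 0
    rw [Function.iterate_succ_apply', show (dirDeriv v)^[k] (fun _ : E => (0 : ℝ)) = fun _ => 0 from ih]
    funext p
    simp [dirDeriv]

/-- `Im` of a real quaternion vanishes. [folklore] -/
theorem imQ_coe (x : ℝ) : imQ (x : ℍ) = 0 := by
  ext <;> simp [imQ]

/-- ★ **The totally-real test configuration has `G ≡ 0`**: leaders `x = y′ = z = 1/2`, followers `y_f = 1/2`, any hub `a₀ ≠ 0`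
(the raw letters move inside `span{1, i}`, an abelian direction of `Â`: ✓`hatA_abelDir_eq_zero`). [cite: Luscher1983, §2] -/
theorem twoScaleDeficit_half_eq_zero {a₀ : ℝ} (ha : a₀ ≠ 0) (u s : ℝ) :
    twoScaleDeficit L u s a₀ (((((1 / 2 : ℝ) : ℍ)), (((1 / 2 : ℝ) : ℍ))), (((1 / 2 : ℝ) : ℍ))) (fun _ : Fol L => (((1 / 2 : ℝ) : ℍ))) = 0 := by
  set q : ℍ := ((1 / 2 : ℝ) : ℍ) with hq
  have hqre : q.re = 1 / 2 := by rw [hq, Quaternion.re_coe]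
  have hqI : q.imI = 0 := by rw [hq, Quaternion.imI_coe]
  have hqJ : q.imJ = 0 := by rw [hq, Quaternion.imJ_coe]
  have hqK : q.imK = 0 := by rw [hq, Quaternion.imK_coe]
  rw [twoScaleDeficit_eq_hatA]
  have hJ : abelDir L (compJ s ((q, q), q)) qJ = 0 := by
    refine Prod.ext (funext fun μ => ?_) rfl
    fin_cases μ <;> simp [abelDir, compJ, hqJ]
  have hK : abelDir L (compK s ((q, q), q)) qK = 0 := by
    refine Prod.ext (funext fun μ => ?_) rfl
    fin_cases μ <;> simp [abelDir, compK, hqK]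
  have h1 : dirOne L s ((q, q), q) = abelDir L (compI ((q, q), q)) qI := by rw [dirOne, hJ, hK, add_zero, add_zero]
  have h2 : dirTwo L s (fun _ : Fol L => q) = 0 := by
    refine Prod.ext rfl (funext fun i => ?_)
    show s • imQ q = 0
    rw [hq, imQ_coe, smul_zero]
  rw [h1, h2, smul_zero, add_zero]
  refine hatA_abelDir_eq_zero (fun i => by show 0 < q.re; rw [hqre]; norm_num) (fun μ => ?_) _ (Or.inl rfl) u
  fin_cases μ <;> simp [baseLead, hqre, ha]

/-- ★ Hence `Φ(0,0;a₀,ξ*) = 0` at the test configuration. [folklore] -/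
theorem twoScalePhi_half_eq_zero {a₀ : ℝ} (ha : a₀ ≠ 0) :
    twoScalePhi L 0 0 a₀ (((((1 / 2 : ℝ) : ℍ)), (((1 / 2 : ℝ) : ℍ))), (((1 / 2 : ℝ) : ℍ))) (fun _ : Fol L => (((1 / 2 : ℝ) : ℍ))) = 0 := by
  have hF : (fun q : ℝ × ℝ => twoScaleDeficit L q.1 q.2 a₀ (((((1 / 2 : ℝ) : ℍ)), (((1 / 2 : ℝ) : ℍ))), (((1 / 2 : ℝ) : ℍ)))
      (fun _ : Fol L => (((1 / 2 : ℝ) : ℍ)))) = fun _ => 0 := funext fun q => twoScaleDeficit_half_eq_zero ha q.1 q.2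
  show twoScaleRemainder (fun q : ℝ × ℝ => twoScaleDeficit L q.1 q.2 a₀ (((((1 / 2 : ℝ) : ℍ)), (((1 / 2 : ℝ) : ℍ))), (((1 / 2 : ℝ) : ℍ)))
      (fun _ : Fol L => (((1 / 2 : ℝ) : ℍ)))) 0 0 = 0
  rw [hF, twoScaleRemainder_zero]
  show dirDerivIter eS 2 (dirDerivIter eU 4 (fun _ : ℝ × ℝ => (0 : ℝ))) (0, 0) / 48 = 0
  rw [dirDerivIter_const_zero, dirDerivIter_const_zero, zero_div]

omit [NeZero L] in
/-- `scaleQ3` is continuous. [folklore] -/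
theorem continuous_scaleQ3 (m l : ℝ) : Continuous (scaleQ3 m l) := by
  have hc : Continuous (scaleQ m l) := LinearMap.continuous_of_finiteDimensional _
  exact (hc.prodMap hc).prodMap hc

/-- ★★ **THE LIMIT IS POSITIVE**: `μ(twoScaleLimitSet L r a₀) > 0` for `r > 0`, `a₀ ≠ 0` — the limit set contains an open neighbourhood of the
totally-real test configuration. [folklore] -/
theorem measure_twoScaleLimitSet_pos {r : ℝ} (hr : 0 < r) {a₀ : ℝ} (ha : a₀ ≠ 0) : 0 < muXi L (twoScaleLimitSet L r a₀) := by
  have hre : Continuous fun q : ℍ => q.re := Quaternion.continuous_re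
  have hL : (0 : ℝ) < L := by exact_mod_cast NeZero.pos L
  -- an open core of K4's dominating event
  set Dcore : Set ((ℍ × ℍ) × ℍ) := {w | (w.1.1.re ^ 2 < 1 ∧ w.1.2.re ^ 2 < 1 ∧ w.2.re ^ 2 < 1) ∧
    (tvSq w.1.1 < 1 ∧ tvSq w.1.2 < 1 ∧ tvSq w.2 < 1) ∧ (pairSq w.1.1 w.1.2 < 1 ∧ pairSq w.1.1 w.2 < 1 ∧ pairSq w.1.2 w.2 < 1)} with hDcore
  have c11 : Continuous fun w : (ℍ × ℍ) × ℍ => w.1.1 := continuous_fst.comp continuous_fst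
  have c12 : Continuous fun w : (ℍ × ℍ) × ℍ => w.1.2 := continuous_snd.comp continuous_fst
  have c2 : Continuous fun w : (ℍ × ℍ) × ℍ => w.2 := continuous_snd
  have hp : ∀ {f g : (ℍ × ℍ) × ℍ → ℍ}, Continuous f → Continuous g → Continuous fun w => pairSq (f w) (g w) :=
    fun hf hg => continuous_pairSq.comp (hf.prodMk hg)
  have hDo : IsOpen Dcore := by
    have e : Dcore = ((({w : (ℍ × ℍ) × ℍ | w.1.1.re ^ 2 < 1} ∩ {w | w.1.2.re ^ 2 < 1}) ∩ {w | w.2.re ^ 2 < 1}) ∩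
        (({w | tvSq w.1.1 < 1} ∩ {w | tvSq w.1.2 < 1}) ∩ {w | tvSq w.2 < 1})) ∩
        (({w | pairSq w.1.1 w.1.2 < 1} ∩ {w | pairSq w.1.1 w.2 < 1}) ∩ {w | pairSq w.1.2 w.2 < 1}) := by
      rw [hDcore]; ext w; simp only [Set.mem_inter_iff, Set.mem_setOf_eq]; tauto
    rw [e]
    exact ((((isOpen_lt ((hre.comp c11).pow 2) continuous_const).inter (isOpen_lt ((hre.comp c12).pow 2) continuous_const)).inter
      (isOpen_lt ((hre.comp c2).pow 2) continuous_const)).inter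
      (((isOpen_lt (continuous_tvSq.comp c11) continuous_const).inter (isOpen_lt (continuous_tvSq.comp c12) continuous_const)).inter
        (isOpen_lt (continuous_tvSq.comp c2) continuous_const))).inter
      (((isOpen_lt (hp c11 c12) continuous_const).inter (isOpen_lt (hp c11 c2) continuous_const)).inter (isOpen_lt (hp c12 c2) continuous_const))
  have hDsub : Dcore ⊆ domSet4 := fun w hw =>
    ⟨hw.1.1, hw.1.2.1, hw.1.2.2, hw.2.1.1.le, hw.2.1.2.1.le, hw.2.1.2.2.le, hw.2.2.1.le, hw.2.2.2.1.le, hw.2.2.2.2.le⟩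
  set U : Set (Xi L) := (scaleQ3 1 (20 * (L : ℝ) ^ 2)⁻¹ ⁻¹' Dcore) ×ˢ
    (Set.univ.pi fun _ : Fol L => {y : ℍ | |y.re| < 1 ∧ ‖y.im‖ < 12 * (L : ℝ) ^ 2 * Real.sqrt 1}) with hU
  have hUo : IsOpen U := by
    refine (hDo.preimage (continuous_scaleQ3 _ _)).prod (isOpen_set_pi Set.finite_univ fun i _ => ?_)
    exact (isOpen_lt (continuous_abs.comp hre) continuous_const).inter (isOpen_lt (continuous_norm.comp Quaternion.continuous_im) continuous_const)
  have hUsub : U ⊆ twoScaleDom L := by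
    rintro ξ ⟨h1, h2⟩
    refine ⟨Or.inl (hDsub h1), Or.inl fun i hi => ?_⟩
    have h := h2 i hi
    exact ⟨h.1, h.2.le⟩
  set O₁ : Set (Xi L) := {ξ : Xi L | (((|ξ.1.1.1.re| < 1 ∧ |ξ.1.1.2.re| < 1) ∧ |ξ.1.2.re| < 1) ∧ ∀ i, |(ξ.2 i).re| < 1) ∧ ∀ i, 0 < (ξ.2 i).re} ∩
    Prod.mk a₀ ⁻¹' (sliceGood L ∩ (fun z : ℝ × Xi L => twoScalePhi L 0 0 z.1 z.2.1 z.2.2) ⁻¹' Set.Iio r) with hO₁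
  have hO₁o : IsOpen O₁ := isOpen_window_pos.inter ((isOpen_sliceGood_inter_phi_lt (L := L) r).preimage (Continuous.prodMk_right a₀))
  have hsubset : O₁ ∩ U ⊆ twoScaleLimitSet L r a₀ := by
    rintro ξ ⟨⟨hw, hs⟩, hU'⟩
    exact ⟨⟨hw, hs⟩, hUsub hU'⟩
  -- the test configuration
  set q : ℍ := ((1 / 2 : ℝ) : ℍ) with hq
  set ξs : Xi L := (((q, q), q), fun _ : Fol L => q) with hξs
  have hqre : q.re = 1 / 2 := by rw [hq, Quaternion.re_coe]
  have hqim : q.im = 0 := by rw [hq, Quaternion.im_coe]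
  have hqI : q.imI = 0 := by rw [hq, Quaternion.imI_coe]
  have hqJ : q.imJ = 0 := by rw [hq, Quaternion.imJ_coe]
  have hqK : q.imK = 0 := by rw [hq, Quaternion.imK_coe]
  have hqabs : |q.re| < 1 := by rw [hqre, abs_of_pos (by norm_num)]; norm_num
  have hmem : ξs ∈ O₁ ∩ U := by
    refine ⟨⟨⟨⟨⟨⟨hqabs, hqabs⟩, hqabs⟩, fun _ => hqabs⟩, fun _ => by rw [hqre]; norm_num⟩, ?_⟩, ?_⟩
    · refine ⟨mem_sliceGood ha (by rw [hqre]; norm_num) (by rw [hqre]; norm_num) (by rw [hqre]; norm_num) (fun _ => by rw [hqre]; norm_num), ?_⟩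
      show twoScalePhi L 0 0 a₀ ((q, q), q) (fun _ : Fol L => q) < r
      rw [hq, twoScalePhi_half_eq_zero ha]; exact hr
    · refine ⟨?_, fun i _ => ⟨hqabs, by rw [hqim, norm_zero]; positivity⟩⟩
      show scaleQ3 1 (20 * (L : ℝ) ^ 2)⁻¹ ((q, q), q) ∈ Dcore
      have hsq : scaleQ 1 (20 * (L : ℝ) ^ 2)⁻¹ q = q := by
        rw [scaleQ_apply]; ext <;> simp [hqI, hqJ, hqK]
      rw [scaleQ3_apply]
      simp only [hsq, hDcore, Set.mem_setOf_eq, hqre, tvSq, pairSq, hqI, hqJ, hqK]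
      norm_num
  exact lt_of_lt_of_le ((hO₁o.inter hUo).measure_pos (muXi L) ⟨ξs, hmem⟩) (measure_mono hsubset)

/-- ★★★★ **THE PERIODIC MASSIVE-MODE RUNG AT FIXED `L` — UNCONDITIONAL**: for every `ε > 0` there is `L₀` such that for every `L ≥ L₀` the
β-logarithmic derivative of the twist trace falls below that of the physical trace by at least `1/2 − 2ε` for all large `β`:
`∃ β₀, ∀ β ≥ β₀, β(log twistTrace_L)′(β) − β(log physTrace_L)′(β) ≤ −(1/2 − 2ε)`.  (✓`relativeGap_fixedL_of_twoScaleLimit_ae` with the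
product-good level, `M_r(a₀) = μ(twoScaleLimitSet L r a₀)`, ★★★ `tendsto_twoScaleVolumeR_of_null`, ★★ `measure_twoScaleLimitSet_pos`.)
HONEST LABEL: fixed `L`, `β → ∞`; NOT the window-uniform statement ⟨24196⟩; the Yang–Mills mass gap is NOT proved. [cite: tHooft1979] [cite: Luscher1983, §2] -/
theorem relativeGap_fixedL_periodic {ε : ℝ} (hε : 0 < ε) :
    ∃ L₀ : ℕ, ∀ (L : ℕ) [NeZero L], L₀ ≤ L →
      ∃ β₀ : ℝ, ∀ β : ℝ, β₀ ≤ β →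
        β * deriv (fun b : ℝ => Real.log (TT.twistTrace L b (2 * L))) β -
            β * deriv (fun b : ℝ => Real.log (TT.physTrace L b (2 * L))) β ≤ -(1 / 2 - 2 * ε) := by
  obtain ⟨L₀, h⟩ := relativeGap_fixedL_of_twoScaleLimit_ae hε
  refine ⟨L₀, fun L _ hL => ?_⟩
  obtain ⟨r, hr, hnull⟩ := exists_good_level (L := L)
  have hr0 : 0 < r := by linarith [hr.1]
  have hr1 : r ≤ 1 := hr.2.le
  have hMmax : muXi L (twoScaleDom L) ≠ ∞ := volume_twoScaleDominator_lt_top.ne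
  have h0 : ∀ᵐ a₀ : ℝ ∂(volume : Measure ℝ), a₀ ≠ 0 := by
    rw [ae_iff]; simp
  have hlim : ∀ᵐ a₀ : ℝ ∂(volume : Measure ℝ), a₀ ^ 2 < 1 →
      Tendsto (fun p : ℝ × ℝ => twoScaleVolumeR L r p.1 p.2 a₀) (𝓝[>] (0 : ℝ) ×ˢ 𝓝[>] (0 : ℝ)) (𝓝 (muXi L (twoScaleLimitSet L r a₀))) := by
    filter_upwards [hnull, h0] with a₀ hn ha h1
    exact tendsto_twoScaleVolumeR_of_null hr0 hr1 ha ((sq_lt_one_iff_abs_lt_one a₀).1 h1).le hn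
  refine h L hL hr0 (fun a₀ => muXi L (twoScaleLimitSet L r a₀)) (muXi L (twoScaleDom L)) hMmax (fun a₀ => measure_twoScaleLimitSet_le r a₀)
    (fun u s => measurable_twoScaleVolumeR_hub r u s) hlim (lintegral_limit_pos hr0 hMmax)
where
  /-- `0 < (∫⁻ a₀ in Ioo (−1) 1, 4π·M_r(a₀)).toReal`. [folklore] -/
  lintegral_limit_pos {L : ℕ} [NeZero L] {r : ℝ} (hr0 : 0 < r) (hMmax : muXi L (twoScaleDom L) ≠ ∞) :
      0 < (∫⁻ a₀ in Set.Ioo (-1 : ℝ) 1, ENNReal.ofReal (4 * Real.pi) * muXi L (twoScaleLimitSet L r a₀) ∂(volume : Measure ℝ)).toReal := by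
    have hf : Measurable fun a₀ : ℝ => ENNReal.ofReal (4 * Real.pi) * muXi L (twoScaleLimitSet L r a₀) :=
      (measurable_measure_twoScaleLimitSet (L := L) r).const_mul _
    refine ENNReal.toReal_pos (ne_of_gt ?_) ?_
    · rw [lintegral_pos_iff_support hf, Measure.restrict_apply' measurableSet_Ioo]
      refine lt_of_lt_of_le (show (0 : ℝ≥0∞) < volume (Set.Ioo (0 : ℝ) 1) by rw [Real.volume_Ioo]; norm_num) (measure_mono fun a ha => ?_)
      refine ⟨?_, ⟨by linarith [ha.1], ha.2⟩⟩
      exact (ENNReal.mul_pos (ENNReal.ofReal_pos.2 (by positivity)).ne' (measure_twoScaleLimitSet_pos (L := L) hr0 ha.1.ne').ne').ne'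
    · refine ne_top_of_le_ne_top (b := ∫⁻ _ in Set.Ioo (-1 : ℝ) 1, ENNReal.ofReal (4 * Real.pi) * muXi L (twoScaleDom L) ∂(volume : Measure ℝ)) ?_
        (setLIntegral_mono' measurableSet_Ioo fun a _ => mul_le_mul' le_rfl (measure_twoScaleLimitSet_le r a))
      rw [setLIntegral_const, Real.volume_Ioo]
      exact ENNReal.mul_ne_top (ENNReal.mul_ne_top ENNReal.ofReal_ne_top hMmax) ENNReal.ofReal_ne_top

/-- ★★★★ **THE FIXED-`L` PERIODIC MEAN ACTION — UNCONDITIONAL**: for every `L ≥ 1`,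
`b·(log sectorWeight_L(b; untwisted))′ − 12 b L⁴ → −(9L⁴ − 3/2)` as `b → ∞` (✓`periodicMeanAction_fixedL_of_twoScale_ae` with the same data).
HONEST LABEL: fixed `L`; the Yang–Mills mass gap is NOT proved. [cite: Luscher1983, §2] [cite: GonzalezarroyoAltes1988] -/
theorem periodicMeanAction_fixedL (L : ℕ) [NeZero L] :
    Tendsto (fun b : ℝ => b * deriv (fun x : ℝ => Real.log (TT.sectorWeight (L := L) x (2 * L - 1) (fun _ => false) (fun _ _ => (1 : ℝ)))) b -
        12 * b * (L : ℝ) ^ 4) atTop (𝓝 (-(9 * (L : ℝ) ^ 4 - 3 / 2))) := by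
  obtain ⟨r, hr, hnull⟩ := exists_good_level (L := L)
  have hr0 : 0 < r := by linarith [hr.1]
  have hr1 : r ≤ 1 := hr.2.le
  have hMmax : muXi L (twoScaleDom L) ≠ ∞ := volume_twoScaleDominator_lt_top.ne
  have h0 : ∀ᵐ a₀ : ℝ ∂(volume : Measure ℝ), a₀ ≠ 0 := by
    rw [ae_iff]; simp
  have hlim : ∀ᵐ a₀ : ℝ ∂(volume : Measure ℝ), a₀ ^ 2 < 1 →
      Tendsto (fun p : ℝ × ℝ => twoScaleVolumeR L r p.1 p.2 a₀) (𝓝[>] (0 : ℝ) ×ˢ 𝓝[>] (0 : ℝ)) (𝓝 (muXi L (twoScaleLimitSet L r a₀))) := by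
    filter_upwards [hnull, h0] with a₀ hn ha h1
    exact tendsto_twoScaleVolumeR_of_null hr0 hr1 ha ((sq_lt_one_iff_abs_lt_one a₀).1 h1).le hn
  exact periodicMeanAction_fixedL_of_twoScale_ae L hr0 hMmax (fun a₀ => measure_twoScaleLimitSet_le r a₀)
    (fun u s => measurable_twoScaleVolumeR_hub r u s) hlim (relativeGap_fixedL_periodic.lintegral_limit_pos hr0 hMmax)

end Summit.QuantumFields.YangMills.Theorems.SwapVirialDeficit.BlowUpRing

end
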